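import Literature.Barriers.CriticalPhenomena.SupercriticalSAWSpaceFillingProblem10
import Literature.Probability.RandomPlanarGeometry.SLEEightThirdsMissesBall
import Literature.Probability.RandomPlanarGeometry.LocalMartingaleProofs
import HarnessLib

/-!
# `RobustSAWScalingLimit` is refuted by Theorem 1 of Duminil-Copin–Kozma–Yadin (2014), the
# restriction formula for SLE_{8/3} and the simplicity of the SLE_{8/3} trace

Topic `Literature/Barriers/CriticalPhenomena`; fourth companion of `SupercriticalSAWSpaceFilling`
(after `…Proofs`, `…Steps` and `…Problem10`). That file defines the *technique class* obstructed by the barrier,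
`SupercriticalSAW.RobustSAWScalingLimit` (chordal SLE_{8/3} convergence of the SAW with parameter
`x` for ALL `x` in a neighbourhood of `x_c = 1/μ`). It is **not** a published result — it implies
the open sub-problem `Literature.Probability.RandomPlanarGeometry.SAW.SAWScalingLimit`
(`RobustSAWScalingLimit.sawScalingLimit`) — and the source shows that it is FALSE: for every
`x > 1/μ` the walk in the unit disk is space-filling (H. Duminil-Copin, G. Kozma, A. Yadin,
*Supercritical self-avoiding walks are space-filling*, Ann. IHP Probab. Stat. 50 (2014) 315–326,
arXiv:1110.3074, **Theorem 1**, p. 2), whereas chordal SLE_{8/3} misses a macroscopic ball with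
positive probability.

This file closes the lattice-side gap "(i)" recorded in `SupercriticalSAWSpaceFillingProofs`
between its mechanism `not_robustSAWScalingLimit_of_unitDisc` and the named facts of the tree
(gap "(ii)", closest sites form an endpoint approximation of `(𝔻; 1, -1)`, is
`isEndpointApprox_unitDisc_of_isClosestSite` of `…Problem10`, with `exists_closestSiteFamily`),
and assembles the refutation:

* `SupercriticalSAW.hasLargeHole_of_forall_notMem_ball` — **the lattice-geometric step**: if a
  SAW `γ` of `𝔻_δ` visits no mesh point of a ball `B(z, r) ⊆ 𝔻`, `8δ ≤ r`, `δ ξ ≤ r/2`, then the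
  `⌊r/(4δ)⌋ + 1` consecutive sites `[z/δ] + (i, 0)`, `0 ≤ i ≤ ⌊r/(4δ)⌋`, have mesh points in
  `B(z, r/2)`, hence lie in `𝔻_δ`, are at graph distance `≥ r/(2δ) ≥ ξ` from `γ` (a lattice path
  of graph-length `n` moves the mesh point by at most `nδ`), so they are vertices of
  `𝔻_δ ∖ Γ_δ^ξ`, pairwise joined there: one component of the hole graph has more than `s` sites
  whenever `s < ⌊r/(4δ)⌋ + 1`.
* `SupercriticalSAW.isSpaceFillingFamily_of_DKY2014_thm1` — hence Theorem 1 (`DKY2014_thm1`)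
  gives the printed weak space-filling property of §1 ("for any open set `U ⊂ Ω`,
  `P[γ_δ ∩ U = ∅] → 0`", `IsSpaceFillingFamily`) in the unit disk, for every `x > x_c` and every
  family of closest sites: `P[γ_δ ∩ U = ∅] ≤ P[hole of > c log(1/δ) sites]` once
  `4cδ log(1/δ) ≤ r` (`δ log δ → 0`, Mathlib `tendsto_log_mul_rpow_nhdsGT_zero`).
* `SupercriticalSAW.not_sawScalingLimitAt_of_DKY2014_thm1`,
  `SupercriticalSAW.not_robustSAWScalingLimit_of_DKY2014_thm1`,
  `SupercriticalSAWSpaceFilling.not_robustSAWScalingLimit` — **the refutation**: from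
  `DKY2014_thm1` [DKY14, Thm 1], the restriction formula `sle_restriction_eightThirds`
  [LSW03, Thm 6.1] and the simple-trace fact `ae_isSimpleTrace_sleTrace_of_le_four` [RS05,
  Thm 6.1] (through `IsSLECurve.exists_ball_measure_disjoint_ne_zero`), for every `x > x_c` the
  SAW with parameter `x` does NOT converge to chordal SLE_{8/3} (`¬ SAWScalingLimitAt x`), and in
  particular `¬ RobustSAWScalingLimit`. The pre-Wiener measure is a probability measure
  unconditionally (`isProjectiveLimit_preWienerMeasure_holds`), so no further hypothesis remains:
  a proof of `RobustSAWScalingLimit` would contradict three published theorems.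
* `SupercriticalSAW.DKY2014_problem10_unitDisc_of_sawScalingLimit_of_facts` — the same two SLE
  inputs fed to `DKY2014_problem10_unitDisc_of_sawScalingLimit` of `…Problem10`: the
  `(𝔻; 1, -1)` instance of Problem 10 follows from `SAWScalingLimit` and the two named SLE facts.

Mathlib: `SimpleGraph.Reachable.exists_walk_length_eq_dist`, `SimpleGraph.ConnectedComponent.sound`,
`Set.le_ncard_of_inj_on_range`, `Nat.lt_floor_add_one`, `tendsto_log_mul_rpow_nhdsGT_zero`,
`tendsto_of_tendsto_of_tendsto_of_le_of_le'`.

## References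

* H. Duminil-Copin, G. Kozma, A. Yadin, *Supercritical self-avoiding walks are space-filling*,
  Ann. Inst. Henri Poincaré Probab. Stat. 50 (2014) 315–326, arXiv:1110.3074: §1 (p. 2: the
  weak sense of space-filling; "`a_δ, b_δ` the two sites of `Ω_δ` closest to `a` and `b`"),
  Theorem 1 (p. 2), Conjecture 11 (p. 8). [DuminilCopinKozmaYadin2014]
* G. F. Lawler, O. Schramm, W. Werner, *Conformal restriction: the chordal case*, J. Amer. Math.
  Soc. 16 (2003) 917–955, Thm. 6.1. [LawlerSchrammWerner2003Restriction]
* S. Rohde, O. Schramm, *Basic properties of SLE*, Ann. of Math. 161 (2005) 883–924, Thm. 6.1.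
  [RohdeSchramm2005]
-/

noncomputable section

open MeasureTheory Filter Topology Metric Set Literature.Probability.LatticeModels
  Literature.Probability.Percolation Literature.Probability.RandomPlanarGeometry
  Literature.Probability.RandomPlanarGeometry.SAW
open scoped ENNReal NNReal

namespace Literature.Barriers.CriticalPhenomena

namespace SupercriticalSAW

/-! ### `𝔻_δ` is finite -/

/-- `𝔻_δ` is finite for `δ > 0` (the disk is bounded, `meshDomain_finite`). [folklore] -/
theorem meshDomain_unitDisk_finite {δ : ℝ} (hδ : 0 < δ) : (meshDomain unitDisk δ).Finite :=
  meshDomain_finite Metric.isBounded_ball hδ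

/-! ### Lattice geometry: walks of `Ω_δ`, mesh distances, a segment of sites in a ball -/

/-- The vertices of a walk of `Ω_δ` starting in `Ω_δ` all lie in `Ω_δ` (edges of `Ω_δ` join sites
of `Ω_δ`). [folklore] -/
theorem walk_support_subset_meshDomain {Ω : Set ℂ} {δ : ℝ} {a b : Site 2}
    (p : (discreteDomainGraph Ω δ).Walk a b) (ha : a ∈ meshDomain Ω δ) :
    ∀ u ∈ p.support, u ∈ meshDomain Ω δ := by
  induction p with
  | nil =>
    intro u hu
    rw [SimpleGraph.Walk.support_nil, List.mem_singleton] at hu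
    exact hu ▸ ha
  | cons h p ih =>
    intro u hu
    rw [SimpleGraph.Walk.support_cons, List.mem_cons] at hu
    rcases hu with rfl | hu
    · exact ha
    · exact ih (discreteDomainGraph_adj_iff.1 h).2.2 u hu

/-- Nearest neighbours of `ℤ²` have mesh points at distance `δ` (`δ ≥ 0`). [folklore] -/
theorem dist_meshPoint_of_zdGraph_adj {δ : ℝ} (hδ : 0 ≤ δ) {x y : Site 2}
    (h : (zdGraph 2).Adj x y) : dist (meshPoint δ x) (meshPoint δ y) = δ := by
  -- the mesh points of `u` and `u + eᵢ` differ by `δ` (`i = 0`) or `δ i` (`i = 1`)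
  have h10 : (1 : Fin 2) ≠ 0 := by decide
  have h01 : (0 : Fin 2) ≠ 1 := by decide
  have key : ∀ (i : Fin 2) (u : Site 2),
      dist (meshPoint δ u) (meshPoint δ (u + Pi.single i 1)) = δ := by
    rw [Fin.forall_fin_two]
    constructor
    · intro u
      have h0 : meshPoint δ u - meshPoint δ (u + Pi.single (0 : Fin 2) 1) = -(δ : ℂ) := by
        apply Complex.ext
        · simp only [Complex.sub_re, meshPoint_re, Pi.add_apply, Pi.single_eq_same, Int.cast_add,
            Int.cast_one, Complex.neg_re, Complex.ofReal_re]
          ring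
        · simp only [Complex.sub_im, meshPoint_im, Pi.add_apply, Pi.single_eq_of_ne h10, add_zero,
            sub_self, Complex.neg_im, Complex.ofReal_im, neg_zero]
      rw [Complex.dist_eq, h0, norm_neg, Complex.norm_real, Real.norm_eq_abs, abs_of_nonneg hδ]
    · intro u
      have h1 : meshPoint δ u - meshPoint δ (u + Pi.single (1 : Fin 2) 1) = -((δ : ℂ) * Complex.I) := by
        apply Complex.ext
        · simp only [Complex.sub_re, meshPoint_re, Pi.add_apply, Pi.single_eq_of_ne h01, add_zero,
            sub_self, Complex.neg_re, Complex.mul_re, Complex.ofReal_re, Complex.I_re, mul_zero,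
            Complex.ofReal_im, Complex.I_im, zero_mul, neg_zero]
        · simp only [Complex.sub_im, meshPoint_im, Pi.add_apply, Pi.single_eq_same, Int.cast_add,
            Int.cast_one, Complex.neg_im, Complex.mul_im, Complex.ofReal_re, Complex.I_im, mul_one,
            Complex.ofReal_im, Complex.I_re, mul_zero, add_zero]
          ring
      rw [Complex.dist_eq, h1, norm_neg, norm_mul, Complex.norm_real, Complex.norm_I, mul_one,
        Real.norm_eq_abs, abs_of_nonneg hδ]
  obtain ⟨i, rfl | rfl⟩ := (zdGraph_adj_iff x y).1 h
  · exact key i x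
  · rw [dist_comm]
    exact key i y

/-- A walk of `Ω_δ` of length `n` moves the mesh point by at most `nδ` (`δ ≥ 0`). [folklore] -/
theorem dist_meshPoint_le_mul_walk_length {Ω : Set ℂ} {δ : ℝ} (hδ : 0 ≤ δ) {u v : Site 2}
    (p : (discreteDomainGraph Ω δ).Walk u v) :
    dist (meshPoint δ u) (meshPoint δ v) ≤ δ * p.length := by
  induction p with
  | nil => simp
  | cons h p ih =>
    rename_i a c _
    have hadj : (zdGraph 2).Adj a c :=
      meshGraph_le_zdGraph _ _ (discreteDomainGraph_le_meshGraph _ _ h)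
    calc dist (meshPoint δ a) (meshPoint δ _)
        ≤ dist (meshPoint δ a) (meshPoint δ c) + dist (meshPoint δ c) (meshPoint δ _) :=
          dist_triangle _ _ _
      _ ≤ δ + δ * p.length := add_le_add (dist_meshPoint_of_zdGraph_adj hδ hadj).le ih
      _ = δ * (SimpleGraph.Walk.cons h p).length := by
          rw [SimpleGraph.Walk.length_cons]; push_cast; ring

/-- The graph distance of `Ω_δ` between two sites joined in `Ω_δ` controls the distance of their
mesh points: `dist(δu, δv) ≤ δ · d_{Ω_δ}(u, v)`. [folklore] -/
theorem dist_meshPoint_le_mul_graphDist {Ω : Set ℂ} {δ : ℝ} (hδ : 0 ≤ δ) {u v : Site 2}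
    (h : (discreteDomainGraph Ω δ).Reachable u v) :
    dist (meshPoint δ u) (meshPoint δ v) ≤ δ * (discreteDomainGraph Ω δ).dist u v := by
  obtain ⟨p, hp⟩ := h.exists_walk_length_eq_dist
  rw [← hp]
  exact dist_meshPoint_le_mul_walk_length hδ p

/-- The horizontal segment of sites `[z/δ] + (i, 0)`, `i ∈ ℕ`, starting at the nearest site to
`z`. [folklore] -/
def segSite (δ : ℝ) (z : ℂ) (i : ℕ) : Site 2 :=
  nearestSite δ z + Pi.single 0 (i : ℤ)

/-- Consecutive sites of the segment are nearest neighbours in `ℤ²`. [folklore] -/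
theorem zdGraph_adj_segSite_succ (δ : ℝ) (z : ℂ) (i : ℕ) :
    (zdGraph 2).Adj (segSite δ z i) (segSite δ z (i + 1)) := by
  refine (zdGraph_adj_iff _ _).2 ⟨0, Or.inl ?_⟩
  simp only [segSite, add_assoc, ← Pi.single_add, Nat.cast_add, Nat.cast_one]

/-- The segment is injective in `i`. [folklore] -/
theorem segSite_injective (δ : ℝ) (z : ℂ) : Function.Injective (segSite δ z) := by
  intro i j h
  have h0 := congrFun h 0
  simp only [segSite, Pi.add_apply, Pi.single_eq_same, add_right_inj, Nat.cast_inj] at h0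
  exact h0

/-- The `i`-th site of the segment has its mesh point at distance `iδ` from that of the nearest
site to `z` (`δ ≥ 0`). [folklore] -/
theorem dist_meshPoint_segSite (δ : ℝ) (hδ : 0 ≤ δ) (z : ℂ) (i : ℕ) :
    dist (meshPoint δ (segSite δ z i)) (meshPoint δ (nearestSite δ z)) = δ * i := by
  rw [Complex.dist_eq]
  have h : meshPoint δ (segSite δ z i) - meshPoint δ (nearestSite δ z) = ((δ * i : ℝ) : ℂ) := by
    apply Complex.ext
    · simp only [Complex.sub_re, meshPoint_re, segSite, Pi.add_apply, Pi.single_eq_same,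
        Int.cast_add, Int.cast_natCast, Complex.ofReal_re]
      ring
    · have h10 : (1 : Fin 2) ≠ 0 := by decide
      simp only [Complex.sub_im, meshPoint_im, segSite, Pi.add_apply, Complex.ofReal_im,
        Pi.single_eq_of_ne h10, add_zero, sub_self]
  rw [h, Complex.norm_real, Real.norm_eq_abs, abs_of_nonneg (by positivity)]

/-- For `i ≤ ⌊r/(4δ)⌋` and `8δ ≤ r` the `i`-th site of the segment has its mesh point in
`B(z, r/2)`. [folklore] -/
theorem dist_meshPoint_segSite_lt {δ r : ℝ} (hδ : 0 < δ) (hδr : 8 * δ ≤ r) (z : ℂ) {i : ℕ}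
    (hi : i ≤ ⌊r / (4 * δ)⌋₊) : dist (meshPoint δ (segSite δ z i)) z < r / 2 := by
  have hr : 0 < r := by linarith
  have h1 : δ * i ≤ r / 4 := by
    have hi' : (i : ℝ) ≤ r / (4 * δ) :=
      (Nat.cast_le.2 hi).trans (Nat.floor_le (by positivity))
    calc δ * i ≤ δ * (r / (4 * δ)) := mul_le_mul_of_nonneg_left hi' hδ.le
      _ = r / 4 := by field_simp
  calc dist (meshPoint δ (segSite δ z i)) z
      ≤ dist (meshPoint δ (segSite δ z i)) (meshPoint δ (nearestSite δ z)) +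
          dist (meshPoint δ (nearestSite δ z)) z := dist_triangle _ _ _
    _ ≤ δ * i + δ := add_le_add (dist_meshPoint_segSite δ hδ.le z i).le
        (dist_meshPoint_nearestSite_le hδ z)
    _ < r / 2 := by linarith

/-! ### The lattice-geometric step: an unvisited ball contains a large hole -/

/-- **An unvisited macroscopic ball is a hole of `≍ r/δ` sites.** Let `γ` be a SAW of `𝔻_δ`
starting at a site of `𝔻_δ` and visiting no mesh point of the ball `B(z, r) ⊆ 𝔻`, with
`8δ ≤ r` and `δξ ≤ r/2`. Then the `⌊r/(4δ)⌋ + 1` sites `[z/δ] + (i, 0)`, `0 ≤ i ≤ ⌊r/(4δ)⌋`, lie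
in `𝔻_δ` (their mesh points are in `B(z, r/2) ⊆ 𝔻`), outside the tube `Γ_δ^ξ` (a site of `𝔻_δ`
at graph distance `< ξ` from a visited site is within `δξ ≤ r/2` of a mesh point outside
`B(z, r)`), and consecutive ones are adjacent in `𝔻_δ ∖ Γ_δ^ξ`; so some component of the hole
graph has more than `s` sites as soon as `s < ⌊r/(4δ)⌋ + 1` — the step "(i)" left open in
`SupercriticalSAWSpaceFillingProofs`. [cite: DuminilCopinKozmaYadin2014, §1 and Theorem 1] -/
theorem hasLargeHole_of_forall_notMem_ball {δ ξ r s : ℝ} {z : ℂ} {a b : Site 2}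
    (hδ : 0 < δ) (hball : ball z r ⊆ unitDisk) (hδr : 8 * δ ≤ r) (hξ : δ * ξ ≤ r / 2)
    (ha : a ∈ meshDomain unitDisk δ) (hs : s < (⌊r / (4 * δ)⌋₊ : ℝ) + 1)
    (γ : DomainSAW unitDisk δ a b) (hγ : ∀ v ∈ γ.walk.support, meshPoint δ v ∉ ball z r) :
    HasLargeHole ξ s γ := by
  set N : ℕ := ⌊r / (4 * δ)⌋₊ with hN
  -- the sites of the segment, `i ≤ N`, are vertices of the hole graph
  have hmemD : ∀ i, i ≤ N → segSite δ z i ∈ meshDomain unitDisk δ := fun i hi => by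
    rw [mem_meshDomain_unitDisk, ← mem_ball_zero_iff]
    exact hball (mem_ball.2 ((dist_meshPoint_segSite_lt hδ hδr z hi).trans_le (by linarith)))
  have hnot : ∀ i, i ≤ N → segSite δ z i ∉ tube ξ γ := by
    rintro i hi ⟨-, u, hu, hdist⟩
    have huD : u ∈ meshDomain unitDisk δ := walk_support_subset_meshDomain γ.walk ha u hu
    have hreach := reachable_discreteDomainGraph_unitDisk huD (hmemD i hi)
    have h1 := dist_meshPoint_le_mul_graphDist hδ.le hreach
    have h2 : δ * ((discreteDomainGraph unitDisk δ).dist u (segSite δ z i) : ℝ) < δ * ξ :=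
      mul_lt_mul_of_pos_left hdist hδ
    have h3 : r ≤ dist (meshPoint δ u) z := by
      by_contra hlt
      exact hγ u hu (mem_ball.2 (not_le.1 hlt))
    have h4 := dist_meshPoint_segSite_lt hδ hδr z hi
    have h5 := dist_triangle (meshPoint δ u) (meshPoint δ (segSite δ z i)) z
    linarith
  have hmem : ∀ i, i ≤ N → segSite δ z i ∈ meshDomain unitDisk δ \ tube ξ γ := fun i hi =>
    ⟨hmemD i hi, hnot i hi⟩
  -- the vertices, as elements of the vertex type of the hole graph
  let f : ℕ → ↥(meshDomain unitDisk δ \ tube ξ γ) := fun i =>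
    if hi : i ≤ N then ⟨segSite δ z i, hmem i hi⟩ else ⟨segSite δ z 0, hmem 0 (Nat.zero_le _)⟩
  have hf : ∀ i, i ≤ N → (f i : Site 2) = segSite δ z i := fun i hi => by
    simp only [f, dif_pos hi]
  -- consecutive ones are adjacent in the hole graph, so all lie in the component of `f 0`
  have hadj : ∀ i, i + 1 ≤ N → (holeGraph ξ γ).Adj (f i) (f (i + 1)) := fun i hi => by
    refine SimpleGraph.induce_adj.2 ?_
    rw [hf i (by omega), hf (i + 1) hi]
    exact discreteDomainGraph_unitDisk_adj.2
      ⟨zdGraph_adj_segSite_succ δ z i, hmemD i (by omega), hmemD (i + 1) hi⟩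
  have hreach : ∀ i, i ≤ N → (holeGraph ξ γ).Reachable (f 0) (f i) := by
    intro i
    induction i with
    | zero => exact fun _ => SimpleGraph.Reachable.refl _
    | succ i ih => exact fun hi => (ih (by omega)).trans (hadj i hi).reachable
  set C : (holeGraph ξ γ).ConnectedComponent := (holeGraph ξ γ).connectedComponentMk (f 0) with hC
  have hsupp : ∀ i < N + 1, f i ∈ C.supp := fun i hi => by
    rw [SimpleGraph.ConnectedComponent.mem_supp_iff, hC]
    exact SimpleGraph.ConnectedComponent.sound (hreach i (by omega)).symm
  -- the vertex type of the hole graph is finite, so the support has at least `N + 1` elements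
  haveI : Finite ↥(meshDomain unitDisk δ \ tube ξ γ) :=
    ((meshDomain_unitDisk_finite hδ).subset sdiff_subset).to_subtype
  have hinj : ∀ i < N + 1, ∀ j < N + 1, f i = f j → i = j := fun i hi j hj hij => by
    have h := congrArg (fun v : ↥(meshDomain unitDisk δ \ tube ξ γ) => (v : Site 2)) hij
    simp only [hf i (by omega), hf j (by omega)] at h
    exact segSite_injective δ z h
  have hcard : N + 1 ≤ C.supp.ncard := Set.le_ncard_of_inj_on_range f hsupp hinj (toFinite _)
  refine ⟨C, hs.trans_le ?_⟩
  exact_mod_cast hcard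

/-! ### From Theorem 1 to the weak space-filling property of §1 -/

/-- The arithmetic of the threshold: if `-(r/(4c)) < δ log δ` (true for small `δ`, since
`δ log δ → 0`) then `c log(1/δ) < ⌊r/(4δ)⌋ + 1`. [folklore] -/
theorem log_threshold {c r δ : ℝ} (hc : 0 < c) (hδ : 0 < δ)
    (h : -(r / (4 * c)) < Real.log δ * δ) :
    c * Real.log (1 / δ) < (⌊r / (4 * δ)⌋₊ : ℝ) + 1 := by
  have h1 : c * Real.log (1 / δ) ≤ r / (4 * δ) := by
    rw [one_div, Real.log_inv, le_div_iff₀ (by positivity)]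
    have h2 : -r < Real.log δ * δ * (4 * c) := by
      have := mul_lt_mul_of_pos_right h (by positivity : (0 : ℝ) < 4 * c)
      rwa [neg_mul, div_mul_cancel₀ _ (by positivity)] at this
    nlinarith
  exact h1.trans_lt (Nat.lt_floor_add_one _)

/-- **Theorem 1 implies the weak space-filling of §1 in the unit disk** ("The subject of this
paper is the proof of a result which quantifies how `γ_δ` becomes space filling", §1, p. 2,
before Theorem 1). If `DKY2014_thm1` holds,
then for boundary points `a ≠ b` of `𝔻`, every family of closest sites `a_δ, b_δ` and every
`x > x_c`, the SAW laws `P_{(𝔻_δ,a_δ,b_δ,x)}` are space-filling in the printed weak sense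
(`IsSpaceFillingFamily`: `P[γ_δ ∩ U = ∅] → 0` for every nonempty open `U ⊆ 𝔻`): with
`B(z, r) ⊆ U`, for small `δ` the event `γ_δ ∩ U = ∅` forces a hole of `> c log(1/δ)` sites
(`hasLargeHole_of_forall_notMem_ball`, `log_threshold`), whose probability tends to `0` by
Theorem 1. [cite: DuminilCopinKozmaYadin2014, §1 and Theorem 1] -/
theorem isSpaceFillingFamily_of_DKY2014_thm1 (h : DKY2014_thm1) {a b : ℂ} (ha : ‖a‖ = 1)
    (hb : ‖b‖ = 1) (hab : a ≠ b) {A B : ℝ → Site 2}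
    (hAB : ∀ δ : ℝ, 0 < δ → IsClosestSite unitDisk δ a (A δ) ∧ IsClosestSite unitDisk δ b (B δ))
    {x : ℝ} (hx : criticalFugacity < x) : IsSpaceFillingFamily x unitDisk A B := by
  intro U hU hUΩ hUne
  obtain ⟨z, hz⟩ := hUne
  obtain ⟨r, hr, hzr⟩ := Metric.isOpen_iff.1 hU z hz
  obtain ⟨ξ, hξ, c, hc, hT⟩ := h a b ha hb hab x hx
  have hT := hT A B hAB
  -- for small `δ`, avoiding `U` forces a hole of more than `c log(1/δ)` sites
  have hlog : ∀ᶠ δ in 𝓝[>] (0 : ℝ), -(r / (4 * c)) < Real.log δ * δ := by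
    have hlim := tendsto_log_mul_rpow_nhdsGT_zero zero_lt_one
    have hev := hlim.eventually (Ioi_mem_nhds (show -(r / (4 * c)) < (0 : ℝ) by
      have : 0 < r / (4 * c) := by positivity
      linarith))
    filter_upwards [hev] with δ hδ
    simpa only [Real.rpow_one] using hδ
  have hsmall : ∀ᶠ δ in 𝓝[>] (0 : ℝ), δ ∈ Ioo 0 (min (r / 8) (r / (2 * ξ))) :=
    Ioo_mem_nhdsGT (lt_min (by positivity) (by positivity))
  have hev : ∀ᶠ δ in 𝓝[>] (0 : ℝ),
      lawAt x unitDisk δ (A δ) (B δ) {γ | ∀ v ∈ γ.walk.support, meshPoint δ v ∉ U} ≤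
        lawAt x unitDisk δ (A δ) (B δ) {γ | HasLargeHole ξ (c * Real.log (1 / δ)) γ} := by
    filter_upwards [hlog, hsmall] with δ hlogδ hδ
    have hδ0 : 0 < δ := hδ.1
    have hδ8 : 8 * δ ≤ r := by
      have := (hδ.2.le.trans (min_le_left _ _))
      linarith
    have hδξ : δ * ξ ≤ r / 2 := by
      have h2 : δ ≤ r / (2 * ξ) := hδ.2.le.trans (min_le_right _ _)
      rw [le_div_iff₀ (by positivity)] at h2
      linarith
    refine measure_mono fun γ hγ => ?_
    exact hasLargeHole_of_forall_notMem_ball hδ0 (hzr.trans hUΩ) hδ8 hδξ (hAB δ hδ0).1.1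
      (log_threshold hc hδ0 hlogδ) γ (fun v hv hvz => hγ v hv (hzr hvz))
  exact tendsto_of_tendsto_of_tendsto_of_le_of_le' tendsto_const_nhds hT
    (Eventually.of_forall fun δ => zero_le) hev

/-! ### The refutation of `RobustSAWScalingLimit` from the named facts -/

/-- **For every supercritical fugacity the SAW does not converge to chordal SLE_{8/3}.** From
Theorem 1 of Duminil-Copin–Kozma–Yadin (`DKY2014_thm1`), the restriction formula for SLE_{8/3}
([LSW03] Thm. 6.1, `sle_restriction_eightThirds`) and the simplicity of the SLE_κ trace for
`κ ≤ 4` ([RS05] Thm. 6.1, `ae_isSimpleTrace_sleTrace_of_le_four`): for every `x > x_c`,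
`¬ SAWScalingLimitAt x` — witnessed by the unit disk `(𝔻; 1, -1)` with closest-site endpoints
(`exists_closestSiteFamily`, `isEndpointApprox_unitDisc_of_isClosestSite`), where the laws are
space-filling (`isSpaceFillingFamily_of_DKY2014_thm1`) while every SLE_{8/3}
random curve misses a ball with positive probability
(`IsSLECurve.exists_ball_measure_disjoint_ne_zero`); the two are incompatible with convergence in
law (`IsSpaceFillingFamily.not_convergesInLawToSLE`). The source conjectures SLE₈ in this regime
(Conjecture 11). [cite: DuminilCopinKozmaYadin2014, Theorem 1 and Conjecture 11] -/
theorem not_sawScalingLimitAt_of_DKY2014_thm1 (h₁ : DKY2014_thm1) (h61 : sle_restriction_eightThirds)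
    (h₆ : ae_isSimpleTrace_sleTrace_of_le_four (κ := (8 : ℝ≥0) / 3)) {x : ℝ}
    (hx : criticalFugacity < x) : ¬ SAWScalingLimitAt x := by
  -- closest-site endpoint families `a_δ → 1`, `b_δ → -1` (`…Problem10`)
  obtain ⟨A, hA⟩ := exists_closestSiteFamily (1 : ℂ)
  obtain ⟨B, hB⟩ := exists_closestSiteFamily (-1 : ℂ)
  have hAB : ∀ δ : ℝ, 0 < δ →
      IsClosestSite unitDisk δ 1 (A δ) ∧ IsClosestSite unitDisk δ (-1) (B δ) :=
    fun δ hδ => ⟨hA δ hδ, hB δ hδ⟩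
  have hne : (1 : ℂ) ≠ -1 := fun h => by
    have h' := congrArg Complex.re h
    norm_num at h'
  exact not_sawScalingLimitAt_of_isSpaceFillingFamily (D := DobrushinDomain.unitDisc)
    (isEndpointApprox_unitDisc_of_isClosestSite hAB)
    (isSpaceFillingFamily_of_DKY2014_thm1 h₁ (a := 1) (b := -1) norm_one (by simp) hne hAB hx)
    (fun _ hΓ => hΓ.exists_ball_measure_disjoint_ne_zero h61 h₆)
    isProjectiveLimit_preWienerMeasure_holds

/-- **`RobustSAWScalingLimit` is false, given the three named facts** `DKY2014_thm1` [DKY14,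
Thm 1], `sle_restriction_eightThirds` [LSW03, Thm 6.1] and `ae_isSimpleTrace_sleTrace_of_le_four`
[RS05, Thm 6.1]: it would give SLE_{8/3} convergence at some `x > x_c`
(`RobustSAWScalingLimit.supercritical`), excluded by `not_sawScalingLimitAt_of_DKY2014_thm1`. In
particular no `theorem RobustSAWScalingLimit_holds` can be proved without contradicting these
published results (and `RobustSAWScalingLimit` also implies the open sub-problem
`SAWScalingLimit`). [cite: DuminilCopinKozmaYadin2014, Theorem 1] -/
theorem not_robustSAWScalingLimit_of_DKY2014_thm1 (h₁ : DKY2014_thm1)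
    (h61 : sle_restriction_eightThirds)
    (h₆ : ae_isSimpleTrace_sleTrace_of_le_four (κ := (8 : ℝ≥0) / 3)) : ¬ RobustSAWScalingLimit := by
  intro h
  obtain ⟨x, hx, hlim⟩ := h.supercritical
  exact not_sawScalingLimitAt_of_DKY2014_thm1 h₁ h61 h₆ hx hlim

/-- **The `(𝔻; 1, -1)` instance of Problem 10 from the Lawler–Schramm–Werner conjecture and the
two named SLE facts.** `DKY2014_problem10_unitDisc_of_sawScalingLimit` (`…Problem10`) with its
SLE inputs supplied: if `SAWScalingLimit` holds, then — by the restriction formula [LSW03,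
Thm 6.1] and the simplicity of the SLE_{8/3} trace [RS05, Thm 6.1]
(`IsSLECurve.exists_ball_measure_disjoint_ne_zero`), the pre-Wiener measure being a probability
measure (`isProjectiveLimit_preWienerMeasure_holds`) — no closest-site critical family
`a_δ → 1`, `b_δ → -1` in the disk is space-filling. Problem 10 itself remains open.
[cite: DuminilCopinKozmaYadin2014, §1 (When x = 1/μ) and §4 Problem 10] -/
theorem DKY2014_problem10_unitDisc_of_sawScalingLimit_of_facts (hSAW : SAWScalingLimit)
    (h61 : sle_restriction_eightThirds)
    (h₆ : ae_isSimpleTrace_sleTrace_of_le_four (κ := (8 : ℝ≥0) / 3)) {A B : ℝ → Site 2}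
    (h : ∀ δ : ℝ, 0 < δ → IsClosestSite unitDisk δ 1 (A δ) ∧ IsClosestSite unitDisk δ (-1) (B δ)) :
    ¬ IsSpaceFillingFamily criticalFugacity unitDisk A B :=
  DKY2014_problem10_unitDisc_of_sawScalingLimit hSAW
    (fun _ hΓ => hΓ.exists_ball_measure_disjoint_ne_zero h61 h₆)
    isProjectiveLimit_preWienerMeasure_holds h

end SupercriticalSAW

/-- **The barrier obstructs its technique class (as a theorem).** The barrier
`SupercriticalSAWSpaceFilling` (= Theorem 1 of Duminil-Copin–Kozma–Yadin 2014), together with the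
restriction formula for SLE_{8/3} [LSW03, Thm 6.1] and the simplicity of the SLE_{8/3} trace
[RS05, Thm 6.1], refutes `SupercriticalSAW.RobustSAWScalingLimit` (SLE_{8/3} convergence for all
fugacities near `x_c`). [cite: DuminilCopinKozmaYadin2014, Theorem 1] -/
theorem SupercriticalSAWSpaceFilling.not_robustSAWScalingLimit (h : SupercriticalSAWSpaceFilling)
    (h61 : sle_restriction_eightThirds)
    (h₆ : ae_isSimpleTrace_sleTrace_of_le_four (κ := (8 : ℝ≥0) / 3)) :
    ¬ SupercriticalSAW.RobustSAWScalingLimit :=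
  SupercriticalSAW.not_robustSAWScalingLimit_of_DKY2014_thm1 (supercriticalSAWSpaceFilling_iff.1 h)
    h61 h₆

end Literature.Barriers.CriticalPhenomena
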